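import Mathlib

/-!
# Sketch — crux-ideate stmt-MatrixMultiplication-14308 (`FourierTwoFamiliesModP.PrimeTwoFamilies`), ideator k = 1

First lemmas of the two idea cards, stated as `Prop`s over existing declarations (Mathlib only;
the SDPP clauses (W),(X) are inlined verbatim in the route's form). Nothing is proved here; the
point is that the statements elaborate.

* `UTSeparated`      — a ONE-DIRECTIONALLY separated ("upper-triangular") family of direct pairs.
* `TensorLemma`      — card `sperner-tensorisation-ut-gadgets`: the antichain-indexed product of a
                       UT-separated family is an SDPP family (CKSU Lemma 21 needs full SDPP; for
                       UT families the index set must be an antichain of `Fin L → Fin T`).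
* `OrbitLemma`       — card `cyclotomic-orbit-development`: developing a base pair `(A₀,B₀)` under a
                       multiplicative subgroup `K ≤ (ℤ/p)ˣ` gives an SDPP family iff the base pair
                       satisfies the two displayed conditions.
* `CountingBound`    — the inclusion–exclusion necessary condition |M| + |Y| ≤ p + min |B_i| used by
                       both cards to locate the feasible parameter window.
-/

namespace Summit.MatrixMultiplication.MatrixMultiplication.Cruxes.PrimeTwoFamilies.IdeatorOne

open Finset

/-- One-directionally separated family of direct pairs in an additive group: (g1) every pair is
direct; (g2) for colours `c' < c` and every mediating colour `ĉ`, `a_c - a_ĉ + b_ĉ - b_{c'} ≠ 0`. -/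
def UTSeparated (H : Type) [AddCommGroup H] (T : ℕ) (A B : Fin T → Finset H) : Prop :=
  (∀ c : Fin T, ∀ a ∈ A c, ∀ a' ∈ A c, ∀ b ∈ B c, ∀ b' ∈ B c,
      (a - a') + (b - b') = 0 → a = a' ∧ b = b') ∧
  (∀ c ĉ c' : Fin T, c' < c → ∀ a ∈ A c, ∀ a' ∈ A ĉ, ∀ b ∈ B ĉ, ∀ b' ∈ B c',
      (a - a') + (b - b') ≠ 0)

/-- FIRST LEMMA of card `sperner-tensorisation-ut-gadgets` (provable now, size M): the product
family of a UT-separated family, indexed by an ANTICHAIN `W` of words `Fin L → Fin T`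
(componentwise order), is an SDPP family in `Fin L → H` — (W) and (X) exactly as in the route. -/
def TensorLemma : Prop :=
  ∀ (H : Type) [AddCommGroup H] [DecidableEq H] (T L : ℕ) (A B : Fin T → Finset H),
    UTSeparated H T A B →
    ∀ W : Finset (Fin L → Fin T), (∀ w ∈ W, ∀ w' ∈ W, (∀ t, w t ≤ w' t) → w = w') →
      (∀ w : W, ∀ a ∈ Fintype.piFinset (fun t => A (w.1 t)), ∀ a' ∈ Fintype.piFinset (fun t => A (w.1 t)),
          ∀ b ∈ Fintype.piFinset (fun t => B (w.1 t)), ∀ b' ∈ Fintype.piFinset (fun t => B (w.1 t)),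
          (a - a') + (b - b') = 0 → a = a' ∧ b = b') ∧
      (∀ i j k : W, ∀ a ∈ Fintype.piFinset (fun t => A (i.1 t)), ∀ a' ∈ Fintype.piFinset (fun t => A (j.1 t)),
          ∀ b ∈ Fintype.piFinset (fun t => B (j.1 t)), ∀ b' ∈ Fintype.piFinset (fun t => B (k.1 t)),
          (a - a') + (b - b') = 0 → i = k)

/-- The UT-SDPP BOUND that follows (CKSU Thm 23 verbatim on composition classes, which are
antichains): for a UT-separated family in a finite abelian group, `∑_c (|A_c||B_c|)^{ω/2} ≤ |H|^{3/2}`.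
Stated with `Literature.Computability.AlgebraicComplexity.omega ℂ`-free exponent `τ` as: every
`τ` with `∑_c (|A_c||B_c|)^{τ/2} > |H|^{3/2}` yields two-families-type designs; here only the
design-side consequence used by the card is recorded (the `Prop` the transfer stub would prove). -/
def UTTransfer : Prop :=
  (∀ ε : ℝ, 0 < ε → ∃ (q T : ℕ) (A B : Fin T → Finset (ZMod q)), 2 ≤ q ∧ (2 : ℝ) ^ (1 / ε) ≤ q ∧
      UTSeparated (ZMod q) T A B ∧ (q : ℝ) ^ (1 / 2 - ε) ≤ T ∧
      ∀ c : Fin T, (q : ℝ) ^ (1 - ε) ≤ (((A c).card * (B c).card : ℕ) : ℝ)) →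
  -- conclusion: the crux, verbatim
  ∀ δ : ℝ, 0 < δ → ∀ n₀ : ℕ, ∃ n ≥ n₀, ∃ p : ℕ, p.Prime ∧ ∃ A B : Fin n → Finset (ZMod p),
    (∀ i : Fin n, ∀ a ∈ A i, ∀ a' ∈ A i, ∀ b ∈ B i, ∀ b' ∈ B i, (a - a') + (b - b') = 0 → a = a' ∧ b = b') ∧
    (∀ i j k : Fin n, ∀ a ∈ A i, ∀ a' ∈ A j, ∀ b ∈ B j, ∀ b' ∈ B k, (a - a') + (b - b') = 0 → i = k) ∧
    (p : ℝ) ≤ (n : ℝ) ^ (2 + δ) ∧ ∀ i : Fin n, (n : ℝ) ^ (2 - δ) ≤ (((A i).card * (B i).card : ℕ) : ℝ)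

/-- FIRST LEMMA of card `cyclotomic-orbit-development` (provable now, size S/M): developing a base
pair under a multiplicative subgroup `K` of `(ℤ/p)ˣ` (given as a finset of nonzero residues closed
under `k k'⁻¹`) yields an SDPP family indexed by `K` as soon as the base pair is direct and
satisfies the displayed two-parameter cross-condition. -/
def OrbitLemma : Prop :=
  ∀ (p : ℕ) [Fact p.Prime] (K A₀ B₀ : Finset (ZMod p)),
    (∀ k ∈ K, k ≠ 0) → (∀ k ∈ K, ∀ k' ∈ K, k * k'⁻¹ ∈ K) →
    (∀ a ∈ A₀, ∀ a' ∈ A₀, ∀ b ∈ B₀, ∀ b' ∈ B₀, (a - a') + (b - b') = 0 → a = a' ∧ b = b') →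
    (∀ k ∈ K, ∀ k' ∈ K, k ≠ k' → ∀ a ∈ A₀, ∀ a' ∈ A₀, ∀ b ∈ B₀, ∀ b' ∈ B₀,
        (k * a - a') + (b - k' * b') ≠ 0) →
    (∀ i : K, ∀ a ∈ A₀.image (i.1 * ·), ∀ a' ∈ A₀.image (i.1 * ·), ∀ b ∈ B₀.image (i.1 * ·),
        ∀ b' ∈ B₀.image (i.1 * ·), (a - a') + (b - b') = 0 → a = a' ∧ b = b') ∧
    (∀ i j k : K, ∀ a ∈ A₀.image (i.1 * ·), ∀ a' ∈ A₀.image (j.1 * ·), ∀ b ∈ B₀.image (j.1 * ·),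
        ∀ b' ∈ B₀.image (k.1 * ·), (a - a') + (b - b') = 0 → i = k)

/-- COUNTING BOUND (necessary condition, provable now, size S): in any SDPP family,
`|⋃_j (A_j - B_j)| + ∑_j |B_j| ≤ |H| + |B_i|` for every `i`, provided all `A_j` are non-empty (because
`(x - M) ∩ Y ⊆ B_i` for `x ∈ A_i`, `M = ⋃ (A_j - B_j)`, `Y = ⨆ B_j`, and inclusion–exclusion; with an
empty `A_j` its `B_j` is unconstrained and the inequality fails, e.g. `A = ({0},∅,∅)`,
`B = ({0}, H∖0, H∖0)`). -/
def CountingBound : Prop :=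
  ∀ (H : Type) [AddCommGroup H] [Fintype H] [DecidableEq H] (n : ℕ) (A B : Fin n → Finset H),
    (∀ i : Fin n, ∀ a ∈ A i, ∀ a' ∈ A i, ∀ b ∈ B i, ∀ b' ∈ B i, (a - a') + (b - b') = 0 → a = a' ∧ b = b') →
    (∀ i j k : Fin n, ∀ a ∈ A i, ∀ a' ∈ A j, ∀ b ∈ B j, ∀ b' ∈ B k, (a - a') + (b - b') = 0 → i = k) →
    (∀ j : Fin n, (A j).Nonempty) → ∀ i : Fin n,
      (Finset.univ.biUnion fun j => ((A j) ×ˢ (B j)).image fun ab => ab.1 - ab.2).card +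
        ∑ j, (B j).card ≤ Fintype.card H + (B i).card


/-! ## Proofs of the two first lemmas (both provable now; the point of recording them is that the
transfer's bookkeeping rests on nothing conjectural). -/

/-- `TensorLemma` holds: antichain-indexed products of a UT-separated family are SDPP. -/
theorem tensorLemma_holds : TensorLemma := by
  intro H _ _ T L A B hUT W hW
  obtain ⟨hg1, hg2⟩ := hUT
  refine ⟨?_, ?_⟩
  · intro w a ha a' ha' b hb b' hb' h
    rw [Fintype.mem_piFinset] at ha ha' hb hb'
    have key : ∀ t, a t = a' t ∧ b t = b' t := fun t =>
      hg1 (w.1 t) (a t) (ha t) (a' t) (ha' t) (b t) (hb t) (b' t) (hb' t)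
        (by have := congrFun h t; simpa using this)
    exact ⟨funext fun t => (key t).1, funext fun t => (key t).2⟩
  · intro i j k a ha a' ha' b hb b' hb' h
    rw [Fintype.mem_piFinset] at ha ha' hb hb'
    by_contra hik
    have key : ∀ t, (a t - a' t) + (b t - b' t) = 0 := fun t => by
      have := congrFun h t; simpa using this
    by_cases hex : ∃ t, k.1 t < i.1 t
    · obtain ⟨t, ht⟩ := hex
      exact hg2 (i.1 t) (j.1 t) (k.1 t) ht (a t) (ha t) (a' t) (ha' t) (b t) (hb t) (b' t) (hb' t) (key t)
    · push_neg at hex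
      exact hik (Subtype.ext (hW i.1 i.2 k.1 k.2 hex))

/-- `OrbitLemma` holds: developing a base pair under a multiplicative subgroup (two conditions). -/
theorem orbitLemma_holds : OrbitLemma := by
  intro p _ K A₀ B₀ hK0 hKdiv hdir hcross
  refine ⟨?_, ?_⟩
  · intro i a ha a' ha' b hb b' hb' h
    simp only [Finset.mem_image] at ha ha' hb hb'
    obtain ⟨α, hα, rfl⟩ := ha
    obtain ⟨α', hα', rfl⟩ := ha'
    obtain ⟨β, hβ, rfl⟩ := hb
    obtain ⟨β', hβ', rfl⟩ := hb'
    have hi : (i.1 : ZMod p) ≠ 0 := hK0 _ i.2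
    have h' : (α - α') + (β - β') = 0 := by
      have : i.1 * ((α - α') + (β - β')) = 0 := by
        have e : i.1 * ((α - α') + (β - β')) = (i.1 * α - i.1 * α') + (i.1 * β - i.1 * β') := by ring
        rw [e]; exact h
      rcases mul_eq_zero.1 this with h0 | h0
      · exact absurd h0 hi
      · exact h0
    obtain ⟨e1, e2⟩ := hdir α hα α' hα' β hβ β' hβ' h'
    exact ⟨by rw [e1], by rw [e2]⟩
  · intro i j k a ha a' ha' b hb b' hb' h
    simp only [Finset.mem_image] at ha ha' hb hb'
    obtain ⟨α, hα, rfl⟩ := ha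
    obtain ⟨α', hα', rfl⟩ := ha'
    obtain ⟨β, hβ, rfl⟩ := hb
    obtain ⟨β', hβ', rfl⟩ := hb'
    have hj : (j.1 : ZMod p) ≠ 0 := hK0 _ j.2
    -- divide by k_j
    set u : ZMod p := i.1 * (j.1)⁻¹ with hu
    set v : ZMod p := k.1 * (j.1)⁻¹ with hv
    have huK : u ∈ K := hKdiv _ i.2 _ j.2
    have hvK : v ∈ K := hKdiv _ k.2 _ j.2
    by_contra hik
    have huv : u ≠ v := by
      intro e
      apply hik
      apply Subtype.ext
      have : u * j.1 = v * j.1 := by rw [e]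
      rw [hu, hv, mul_assoc, mul_assoc, inv_mul_cancel₀ hj, mul_one, mul_one] at this
      exact this
    have h' : (u * α - α') + (β - v * β') = 0 := by
      have e : j.1 * ((u * α - α') + (β - v * β')) = (i.1 * α - j.1 * α') + (j.1 * β - k.1 * β') := by
        rw [hu, hv]; field_simp
      have : j.1 * ((u * α - α') + (β - v * β')) = 0 := by rw [e]; exact h
      rcases mul_eq_zero.1 this with h0 | h0
      · exact absurd h0 hj
      · exact h0
    exact hcross u huK v hvK huv α hα α' hα' β hβ β' hβ' h'


/-- `CountingBound` holds. -/
theorem countingBound_holds : CountingBound := by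
  intro H _ _ _ n A B hW hX hne i
  classical
  -- pairwise disjointness of the B-sides
  have hdisj : ∀ j k : Fin n, j ≠ k → Disjoint (B j) (B k) := by
    intro j k hjk
    rw [Finset.disjoint_left]
    intro b hbj hbk
    obtain ⟨a, ha⟩ := hne j
    exact hjk (hX j j k a ha a ha b hbj b hbk (by simp))
  set M : Finset H := Finset.univ.biUnion fun j => ((A j) ×ˢ (B j)).image fun ab => ab.1 - ab.2 with hM
  set Y : Finset H := Finset.univ.biUnion fun j => B j with hY
  have hYcard : Y.card = ∑ j, (B j).card := by
    rw [hY, Finset.card_biUnion]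
    intro j _ k _ hjk
    exact hdisj j k hjk
  obtain ⟨x, hx⟩ := hne i
  set N : Finset H := M.image fun d => x - d with hN
  have hNcard : N.card = M.card := by
    rw [hN]
    exact Finset.card_image_of_injective _ (fun d d' h => by simpa using h)
  -- (x - M) ∩ Y ⊆ B i
  have hsub : N ∩ Y ⊆ B i := by
    intro y hy
    rw [Finset.mem_inter] at hy
    obtain ⟨hyN, hyY⟩ := hy
    rw [hN, Finset.mem_image] at hyN
    obtain ⟨d, hdM, rfl⟩ := hyN
    rw [hM, Finset.mem_biUnion] at hdM
    obtain ⟨j, -, hdj⟩ := hdM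
    rw [Finset.mem_image] at hdj
    obtain ⟨⟨a', b⟩, hab, rfl⟩ := hdj
    rw [Finset.mem_product] at hab
    obtain ⟨ha', hb⟩ := hab
    rw [hY, Finset.mem_biUnion] at hyY
    obtain ⟨k, -, hyk⟩ := hyY
    have hik : i = k := hX i j k x hx a' ha' b hb _ hyk (by simp only; abel)
    rw [hik]; exact hyk
  have h1 : (N ∪ Y).card ≤ Fintype.card H := Finset.card_le_univ _
  have h2 : (N ∪ Y).card + (N ∩ Y).card = N.card + Y.card := Finset.card_union_add_card_inter N Y
  have h3 : (N ∩ Y).card ≤ (B i).card := Finset.card_le_card hsub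
  rw [← hNcard, ← hYcard]
  omega

end Summit.MatrixMultiplication.MatrixMultiplication.Cruxes.PrimeTwoFamilies.IdeatorOne
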